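import Summits.CriticalPhenomena.PercolationContinuityZ3.Theorems.PercNearOneGluingNoHeavyQuantSGCLightCellsAtoms3
import Summits.CriticalPhenomena.PercolationContinuityZ3.Theorems.PercNearOneGluingNoHeavyQuantLawDecAbsorbPairs
import HarnessLib

/-!
# QUANT lane R8, T-DEC, leg (III): TOOLS for the explicit light cells of `SingleGateConvClosed` — an admissible LIGHT pair has a
# self-sufficient low atom (`2·lo ≥ q·mean`), and the ONE-LOW CAPACITY CRITERION for DEC(j′) (the only low atom is `0`)

builds on p205010 (kernel theorem, internal audit signed; external expert review pending)

Support file (`--supports stmt-CriticalPhenomena-4575`), QUANT lane, TYPER seat prim-quant-stmt (gen 31), rung R8 of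
`run/shared/lean/prim/quant/LADDER.md`; companion of `…QuantSGCLightCellsBoth` (cells PP / PT / TT).  Theorems only, standard axioms,
no sorries, no definitions.

THE STRUCTURE OF CELL PP (typer g31, exact census `explore/pp_struct.py`: 57 682 admissible light pairs, 315 005 PP layer instances,
0 exceptions to each of (a)–(c)).
(a) In an admissible LIGHT two-point factor `{lo, hi; γ}` of `SingleGateConvClosed` (`lo < hi ≤ M`, `q·γ < y`, `gate_q{lo, hi; γ}` DEC at
    every layer `j′ < M` at floor `y`) the low atom is SELF-SUFFICIENT: `q·(lo + (hi − lo)γ) ≤ 2·lo`.  Proof: otherwise the layer `j′ = lo`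
    is dominant (`2j′ <` mean) and `LawDec.tail_ge_of_decAt` gives `y ≤` (mass above `lo`) `= q·γ`, contradicting lightness.
    — `LawDec.lightPair_two_lo_ge` below.
(b) Hence in `P = gate_q({lo₁, hi₁; γ₁} ∗ {lo₂, hi₂; γ₂})` the charged atoms `lo₁+lo₂ ≤ lo₁+hi₂, hi₁+lo₂ ≤ hi₁+hi₂` are all self-sufficient
    at the target `t = t₁ + t₂` (`2(lo₁+lo₂) ≥ t₁ + t₂`), and the ONLY low atom of `P` at any layer is the gate zero (mass `1 − q`).
(c) For such a law DEC(j′) is EQUIVALENT to the one-low CAPACITY inequality: the zero mass is at most what the giants (`k ≥ j′+1`, gate `y`,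
    `(1−y)/y` per unit of mass) and the far mids (`t < k ≤ j′`, credit pair `{0, k}` at its minimal credit gate `g_k = max(t/k, y² + (1−y)t/k)`,
    `(1−g_k)/g_k` per unit of mass) can absorb.  The sufficiency half is `LawDec.decAt_of_zeroCapacity` below (criterion E when the
    giants suffice, criterion D = `decAt_of_absorb_flows` with a PROPORTIONAL allocation of the residual zero mass otherwise).
So cell PP (and every "only-zero-low" law) is a finite family of explicit real inequalities in its parameters; the hypotheses of PP are the
same capacity inequalities for the two gated pairs `{0: 1−q, loᵢ: q(1−γᵢ), hiᵢ: qγᵢ}`.  Tight instances exist with one hypothesis slack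
(e.g. `q = 2/3`, `y = 1/2`, `{1,4; 2/3} ⊗ {6,9; 1/4}`: conclusion tight at `j′ = 12`, pair-1 slack `1/9`, pair-2 tight), so the arms'
regime certificates — not one positive combination — are the expected proof shape (as for `GatedSliceMixLaw'`).

* `LawDec.sum_Ico_gate_TP` — the mass of `gate_q{lo, hi; γ}` strictly above `lo` is `q·γ`.
* **`LawDec.lightPair_two_lo_ge`** — (a);  `LawDec.lightPair_lo_pos` — top-affordability of a light pair forces `lo ≥ 1`.
* **`LawDec.decAt_of_zeroCapacity`** — (c), sufficiency: law `μ` on `{0..M}`, floor `0 < x < 1`, layer `j′ < M`; every charged atom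
  `0 < k ≤ j′` self-sufficient (`mean ≤ 2k`); gates `0 < g k ≤ 1` with `{0, k; g k}` valid whenever used; capacity
  `x·μ 0 ≤ (1−x)·P_G + x·Σ_{1 ≤ k ≤ j′} μ k (1 − g k)/g k` ⟹ `DECAt x j′ M μ`.
* (companion file `…QuantSGCLightPairPairLaw`): the five atoms of `gate_q({lo₁, hi₁; γ₁} ∗ {lo₂, hi₂; γ₂})` explicitly, (b), PP's conclusion at a
  layer from the capacity inequality for the explicit law (`sgcLightPairPair_decAt_of_capacity`), and the first regime `j′ < lo₁ + lo₂`.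
HONEST STATUS: PP / PT / TT, `SGCLightPair`, `SGCLightTriple`, `WindowMixDEC`, `SingleGateConvClosed`, `GateMove`, `TreeDEC`, `FarTreeRow`
are OPEN; nothing here is a published result; RATE class log\* / honest sentence unchanged.

[this work]; criteria E / D: prim-quant-census-2 g52 (`…QuantLawDecAbsorb`, `…AbsorbPairs`), `tail_ge_of_decAt`: prim-quant-stmt g18,
`lconv_TP`: prim-quant lane (this lane).  The gluing rows served [cite: KozmaNitzan2024, Conjecture 3 (p. 15)]; product measure
[cite: Grimmett1999, §1.3 p. 10].
-/

noncomputable section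

namespace Summit.CriticalPhenomena.PercolationContinuityZ3.Theorems

namespace Quant

open Finset

/-- two-point law notation `TP[lo, hi, g, h] = g·[h = hi] + (1 − g)·[h = lo]` (as in the lane's other files). -/
local notation3 "TP[" lo ", " hi ", " g ", " h "]" =>
  (g : ℝ) * (if (h : ℕ) = (hi : ℕ) then (1 : ℝ) else 0) + (1 - (g : ℝ)) * (if (h : ℕ) = (lo : ℕ) then (1 : ℝ) else 0)

namespace LawDec

/-! ### (a) An admissible light pair has a self-sufficient low atom -/

/-- the mass of the gated pair `gate_q{lo, hi; γ}` strictly above `lo` (within `{0..M}`, `lo < hi ≤ M`) is `q·γ`. [this work] -/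
theorem sum_Ico_gate_TP (q γ : ℝ) (M lo hi : ℕ) (hlohi : lo < hi) (hhi : hi ≤ M) :
    ∑ h ∈ Finset.Ico (lo + 1) (M + 1), gate (fun k => TP[lo, hi, γ, k]) q h = q * γ := by
  have e1 : ∀ h ∈ Finset.Ico (lo + 1) (M + 1),
      gate (fun k => TP[lo, hi, γ, k]) q h = q * γ * (if h = hi then (1 : ℝ) else 0) := by
    intro h hh
    have h1 : lo + 1 ≤ h := (Finset.mem_Ico.1 hh).1
    simp only [gate]
    rw [if_neg (show h ≠ lo by omega), if_neg (show h ≠ 0 by omega)]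
    ring
  rw [Finset.sum_congr rfl e1, ← Finset.mul_sum, Finset.sum_ite_eq' (Finset.Ico (lo + 1) (M + 1)) hi,
    if_pos (Finset.mem_Ico.2 ⟨Nat.succ_le_of_lt hlohi, Nat.lt_succ_of_le hhi⟩), mul_one]

/-- **(a) THE LOW ATOM OF AN ADMISSIBLE LIGHT PAIR IS SELF-SUFFICIENT.**  If `lo < hi ≤ M`, `0 ≤ γ ≤ 1`, `q·γ < y ≤ 1`, and the gated
pair `gate_q{lo, hi; γ}` is DEC at every layer `j′ < M` at floor `y` (the hypotheses of `SingleGateConvClosed` / cells L2, PP, PT on a light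
two-point factor), then `q·(lo + (hi − lo)γ) ≤ 2·lo`: otherwise the layer `lo` is dominant and `tail_ge_of_decAt` yields `y ≤ q·γ`. [this work] -/
theorem lightPair_two_lo_ge (y q γ : ℝ) (M lo hi : ℕ) (hy1 : y ≤ 1) (hlohi : lo < hi) (hhi : hi ≤ M) (hγ0 : 0 ≤ γ) (hγ1 : γ ≤ 1)
    (hlight : q * γ < y) (hD : ∀ j', j' < M → DECAt y j' M (gate (fun h => TP[lo, hi, γ, h]) q)) :
    q * ((lo : ℝ) + ((hi : ℝ) - lo) * γ) ≤ 2 * (lo : ℝ) := by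
  by_contra hlt
  rw [not_le] at hlt
  obtain ⟨-, -, -, hmean⟩ := twoPointMix_laws (ι := Unit) M ((lo : ℝ) + ((hi : ℝ) - lo) * γ) (fun _ => (1 : ℝ)) (fun _ => γ)
    (fun _ => lo) (fun _ => hi) (fun _ => zero_le_one) (by simp) (fun _ => ⟨hγ0, hγ1⟩) (fun _ => hlohi.le) (fun _ => hhi)
    (fun _ _ => rfl)
  simp only [Finset.univ_unique, Finset.sum_singleton, one_mul] at hmean
  have hm : ∑ h ∈ Finset.range (M + 1), (h : ℝ) * gate (fun h => TP[lo, hi, γ, h]) q h = q * ((lo : ℝ) + ((hi : ℝ) - lo) * γ) := by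
    rw [sum_mul_gate, hmean]
  have htail := tail_ge_of_decAt y lo M _ hy1 (hD lo (lt_of_lt_of_le hlohi hhi)) (by rw [hm]; linarith)
  rw [sum_Ico_gate_TP q γ M lo hi hlohi hhi] at htail
  linarith

/-- **the low atom of a top-affordable light pair is positive**: `lo < hi ≤ M`, `0 < y`, `q·γ < y` and `y·M ≤ q·(lo + (hi−lo)γ)`
force `1 ≤ lo` (with `lo = 0` the right-hand side is `hi·(qγ) < hi·y ≤ M·y`). [this work] -/
theorem lightPair_lo_pos (y q γ : ℝ) (M lo hi : ℕ) (hy0 : 0 < y) (hlohi : lo < hi) (hhi : hi ≤ M)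
    (hlight : q * γ < y) (hta : y * (M : ℝ) ≤ q * ((lo : ℝ) + ((hi : ℝ) - lo) * γ)) : 1 ≤ lo := by
  by_contra hlt
  have hlo : lo = 0 := by omega
  subst hlo
  have hhi0 : (1 : ℝ) ≤ hi := by exact_mod_cast (Nat.succ_le_of_lt hlohi)
  have hM : (hi : ℝ) ≤ M := by exact_mod_cast hhi
  rw [Nat.cast_zero, zero_add, sub_zero] at hta
  have h1 : q * ((hi : ℝ) * γ) = (hi : ℝ) * (q * γ) := by ring
  rw [h1] at hta
  have h2 : (hi : ℝ) * (q * γ) < (hi : ℝ) * y := mul_lt_mul_of_pos_left hlight (by linarith)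
  have h3 : (hi : ℝ) * y ≤ (M : ℝ) * y := mul_le_mul_of_nonneg_right hM hy0.le
  linarith

/-! ### (c) The one-low capacity criterion -/

/-- **THE ONE-LOW CAPACITY CRITERION.**  Law `μ ≥ 0` on `{0..M}` (mass `1`, mean `T`), floor `0 < x < 1`, layer `j′ < M`.  Suppose every
charged atom `0 < k ≤ j′` is self-sufficient (`T ≤ 2k`) — so the only possible low atom is `0` — and gates `0 < g k ≤ 1` are given such
that the zero pair `{0, k; g k}` is valid at `(x, T, j′)` for every charged `0 < k ≤ j′` with `g k < 1` (e.g. the minimal credit gate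
`max(T/k, x² + (1−x)T/k)` when `T < k`, `validAt_creditPair`; atoms that cannot absorb get `g k = 1`, capacity `0`).  If the zero mass fits
into the capacities — `x·μ 0 ≤ (1−x)·Σ_{k > j′} μ k + x·Σ_{1 ≤ k ≤ j′} μ k·(1 − g k)/g k` — then `μ` is DEC(j′).  Proof: if the giants
alone suffice, criterion E (`decAt_of_giantsAbsorbLows`); otherwise the giants absorb `(1−x)P_G/x` of the zero at gate `x` and the rest
is routed to the mids PROPORTIONALLY to their capacities (criterion D, `decAt_of_absorb_flows`). [this work] -/
theorem decAt_of_zeroCapacity (x : ℝ) (j' M : ℕ) (μ : ℕ → ℝ) (g : ℕ → ℝ) (hjM : j' < M)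
    (hμ0 : ∀ h, 0 ≤ μ h) (hμM : ∀ h, M < h → μ h = 0) (hμ1 : ∑ h ∈ Finset.range (M + 1), μ h = 1)
    (hx0 : 0 < x) (hx1 : x < 1)
    (hself : ∀ k, 0 < k → k ≤ j' → 0 < μ k → (∑ h ∈ Finset.range (M + 1), (h : ℝ) * μ h) ≤ 2 * (k : ℝ))
    (hg : ∀ k, 0 < g k ∧ g k ≤ 1)
    (hvalid : ∀ k, 0 < k → k ≤ j' → 0 < μ k → g k < 1 →
      ValidAt x (∑ h ∈ Finset.range (M + 1), (h : ℝ) * μ h) j' 0 k (g k))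
    (hcap : x * μ 0 ≤ (1 - x) * ∑ h ∈ Finset.Ico (j' + 1) (M + 1), μ h
        + x * ∑ k ∈ Finset.Ico 1 (j' + 1), μ k * (1 - g k) / g k) :
    DECAt x j' M μ := by
  set T : ℝ := ∑ h ∈ Finset.range (M + 1), (h : ℝ) * μ h with hT
  obtain ⟨PG, hPG⟩ : ∃ P : ℝ, P = ∑ h ∈ Finset.Ico (j' + 1) (M + 1), μ h := ⟨_, rfl⟩
  obtain ⟨CN, hCN⟩ : ∃ C : ℝ, C = ∑ k ∈ Finset.Ico 1 (j' + 1), μ k * (1 - g k) / g k := ⟨_, rfl⟩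
  rw [← hPG, ← hCN] at hcap
  have hPG0 : 0 ≤ PG := by rw [hPG]; exact Finset.sum_nonneg fun h _ => hμ0 h
  -- capacities are nonnegative
  have hcapk : ∀ k, 0 ≤ μ k * (1 - g k) / g k := fun k =>
    div_nonneg (mul_nonneg (hμ0 k) (by linarith [(hg k).2])) (hg k).1.le
  have hCN0 : 0 ≤ CN := by rw [hCN]; exact Finset.sum_nonneg fun k _ => hcapk k
  -- a positive atom below the layer that is not self-sufficient carries no mass
  have hnolow : ∀ k, 0 < k → k ≤ j' → 2 * (k : ℝ) < T → μ k = 0 := by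
    intro k hk hkj hlt
    rcases (hμ0 k).eq_or_lt with hz | hpos
    · exact hz.symm
    · exact absurd (hself k hk hkj hpos) (not_le.2 hlt)
  -- the low mass below the layer is at most `μ 0`
  have hlowle : ∑ h ∈ Finset.range (j' + 1), (if 2 * (h : ℝ) < T then μ h else 0) ≤ μ 0 := by
    have hterm : ∀ h ∈ Finset.range (j' + 1), (if 2 * (h : ℝ) < T then μ h else 0) ≤ if h = 0 then μ 0 else 0 := by
      intro h hmem
      by_cases h0 : h = 0
      · subst h0; rw [if_pos rfl]; split_ifs <;> [exact le_rfl; exact hμ0 0]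
      · rw [if_neg h0]
        split_ifs with hlt
        · exact (hnolow h (Nat.pos_of_ne_zero h0) (Nat.lt_succ_iff.1 (Finset.mem_range.1 hmem)) hlt).le
        · exact le_rfl
    refine (Finset.sum_le_sum hterm).trans ?_
    rw [Finset.sum_ite_eq' (Finset.range (j' + 1)) 0 (fun _ => μ 0), if_pos (Finset.mem_range.2 (Nat.succ_pos j'))]
  by_cases hA : x * μ 0 ≤ (1 - x) * PG
  · -- the giants suffice: criterion E
    refine decAt_of_giantsAbsorbLows x j' M μ hjM hμ0 hμM hμ1 hx0 ?_
    rw [← hPG]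
    exact (mul_le_mul_of_nonneg_left hlowle hx0.le).trans hA
  · -- the giants absorb `CG = (1-x) PG / x`, the rest `R = μ 0 - CG` goes to the mids proportionally to their capacities
    rw [not_le] at hA
    obtain ⟨CG, hCG⟩ : ∃ C : ℝ, C = (1 - x) * PG / x := ⟨_, rfl⟩
    have hxCG : x * CG = (1 - x) * PG := by rw [hCG]; field_simp
    have hCG0 : 0 ≤ CG := by rw [hCG]; exact div_nonneg (mul_nonneg (by linarith) hPG0) hx0.le
    have hCGlt : CG < μ 0 := by
      by_contra hle; rw [not_lt] at hle
      have := mul_le_mul_of_nonneg_left hle hx0.le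
      linarith
    obtain ⟨R, hR⟩ : ∃ R : ℝ, R = μ 0 - CG := ⟨_, rfl⟩
    have hR0 : 0 < R := by rw [hR]; linarith
    have hRCN : R ≤ CN := by
      rw [hR]
      have h1 : x * (μ 0 - CG) ≤ x * CN := by rw [mul_sub, hxCG]; linarith
      exact le_of_mul_le_mul_left h1 hx0
    have hCNpos : 0 < CN := lt_of_lt_of_le hR0 hRCN
    -- `T > 0`: some mid carries mass
    have hTpos : 0 < T := by
      by_contra hle; rw [not_lt] at hle
      have hzero : ∀ k ∈ Finset.Ico 1 (j' + 1), μ k * (1 - g k) / g k = 0 := by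
        intro k hk
        have hk1 : 1 ≤ k := (Finset.mem_Ico.1 hk).1
        rcases (hμ0 k).eq_or_lt with hz | hpos
        · rw [← hz]; ring
        · exfalso
          have hkT : (k : ℝ) * μ k ≤ T := by
            rw [hT]
            exact Finset.single_le_sum (f := fun h : ℕ => (h : ℝ) * μ h) (fun h _ => mul_nonneg (Nat.cast_nonneg h) (hμ0 h))
              (Finset.mem_range.2 (by have := (Finset.mem_Ico.1 hk).2; omega))
          have : (0 : ℝ) < (k : ℝ) * μ k := mul_pos (by exact_mod_cast hk1) hpos
          linarith
      have : CN = 0 := by rw [hCN]; exact Finset.sum_eq_zero hzero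
      linarith
    -- data for criterion D
    set f : ℕ → ℝ := fun h => if h = 0 then CG else 0 with hf
    set u : ℕ → ℕ → ℝ := fun l m => if l = 0 ∧ 0 < m ∧ m ≤ j' then R * (μ m * (1 - g m) / g m) / CN else 0 with hu
    set G : ℕ → ℕ → ℝ := fun _ m => if g m < 1 then g m else 0 with hGdef
    have hf0 : ∀ h, 0 ≤ f h := fun h => by simp only [hf]; split_ifs <;> [exact hCG0; exact le_rfl]
    have hfsum : ∑ h ∈ Finset.range (j' + 1), f h = CG := by
      rw [Finset.sum_ite_eq' (Finset.range (j' + 1)) 0 (fun _ => CG), if_pos (Finset.mem_range.2 (Nat.succ_pos j'))]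
    have hbal : x * ∑ h ∈ Finset.range (j' + 1), f h = (1 - x) * ∑ h ∈ Finset.Ico (j' + 1) (M + 1), μ h := by
      rw [hfsum, hxCG, hPG]
    have hu0 : ∀ l m, 0 ≤ u l m := fun l m => by
      simp only [hu]; split_ifs
      · exact div_nonneg (mul_nonneg hR0.le (hcapk m)) hCNpos.le
      · exact le_rfl
    have hG : ∀ l m, 0 ≤ G l m ∧ G l m < 1 := fun l m => by
      simp only [hGdef]; split_ifs with h1
      · exact ⟨(hg m).1.le, h1⟩
      · exact ⟨le_rfl, zero_lt_one⟩
    -- a used pair is `(0, m)` with `m` a charged mid and `g m < 1`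
    have hused : ∀ l m, 0 < u l m → l = 0 ∧ 0 < m ∧ m ≤ j' ∧ 0 < μ m ∧ g m < 1 := by
      intro l m hpos
      simp only [hu] at hpos
      split_ifs at hpos with hc
      · obtain ⟨hl, hm, hmj⟩ := hc
        have hcm : 0 < μ m * (1 - g m) / g m := by
          by_contra hle; rw [not_lt] at hle
          have : R * (μ m * (1 - g m) / g m) / CN ≤ 0 :=
            div_nonpos_of_nonpos_of_nonneg (mul_nonpos_of_nonneg_of_nonpos hR0.le hle) hCNpos.le
          linarith
        have hμm : 0 < μ m := by
          by_contra hle; rw [not_lt] at hle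
          have hz : μ m = 0 := le_antisymm hle (hμ0 m)
          rw [hz, zero_mul, zero_div] at hcm; exact lt_irrefl _ hcm
        have hgm : g m < 1 := by
          by_contra hle; rw [not_lt] at hle
          have h1 : g m = 1 := le_antisymm (hg m).2 hle
          rw [h1, sub_self, mul_zero, zero_div] at hcm; exact lt_irrefl _ hcm
        exact ⟨hl, hm, hmj, hμm, hgm⟩
      · exact absurd hpos (lt_irrefl _)
    have huse : ∀ l m, 0 < u l m → l < m ∧ m ≤ j' ∧ 2 * (l : ℝ) < T ∧ T ≤ 2 * (m : ℝ) ∧ ValidAt x T j' l m (G l m) := by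
      intro l m hpos
      obtain ⟨hl, hm, hmj, hμm, hgm⟩ := hused l m hpos
      subst hl
      refine ⟨hm, hmj, by rw [Nat.cast_zero, mul_zero]; exact hTpos, hself m hm hmj hμm, ?_⟩
      simp only [hGdef]; rw [if_pos hgm]
      exact hvalid m hm hmj hμm hgm
    -- the zero's residual mass is fully routed
    have hsumcap : ∑ m ∈ Finset.range (j' + 1), (if 0 < m ∧ m ≤ j' then μ m * (1 - g m) / g m else 0) = CN := by
      rw [hCN]
      have e : Finset.range (j' + 1) = insert 0 (Finset.Ico 1 (j' + 1)) := by
        ext k; simp only [Finset.mem_range, Finset.mem_insert, Finset.mem_Ico]; omega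
      rw [e, Finset.sum_insert (by simp), if_neg (by omega), zero_add]
      refine Finset.sum_congr rfl fun m hm => ?_
      have := Finset.mem_Ico.1 hm
      rw [if_pos ⟨by omega, by omega⟩]
    have hlow : ∀ l, l ≤ j' → 2 * (l : ℝ) < T → ∑ m ∈ Finset.range (j' + 1), u l m = μ l - f l := by
      intro l hlj hlt
      by_cases hl : l = 0
      · subst hl
        have e : ∀ m ∈ Finset.range (j' + 1), u 0 m = (R / CN) * (if 0 < m ∧ m ≤ j' then μ m * (1 - g m) / g m else 0) := by
          intro m _
          simp only [hu, true_and]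
          split_ifs <;> ring
        rw [Finset.sum_congr rfl e, ← Finset.mul_sum, hsumcap, div_mul_cancel₀ _ hCNpos.ne']
        simp only [hf, if_pos rfl]; rw [hR]
      · have hz : μ l = 0 := hnolow l (Nat.pos_of_ne_zero hl) hlj hlt
        have e : ∀ m ∈ Finset.range (j' + 1), u l m = 0 := fun m _ => by simp only [hu]; rw [if_neg (fun hc => hl hc.1)]
        rw [Finset.sum_congr rfl e, Finset.sum_const_zero, hz]
        simp only [hf]; rw [if_neg hl]; ring
    have hcap' : ∀ h, h ≤ j' → T ≤ 2 * (h : ℝ) →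
        ∑ l ∈ Finset.range (j' + 1), G l h * (u l h / (1 - G l h)) ≤ μ h - f h := by
      intro h hhj hTh
      have hh0 : h ≠ 0 := by rintro rfl; rw [Nat.cast_zero, mul_zero] at hTh; linarith
      have hfh : f h = 0 := by simp only [hf]; rw [if_neg hh0]
      rw [hfh, sub_zero]
      -- only `l = 0` contributes
      rw [Finset.sum_eq_single 0]
      · by_cases hgh : g h < 1
        · have e1 : G 0 h = g h := by simp only [hGdef]; rw [if_pos hgh]
          have e2 : u 0 h = R * (μ h * (1 - g h) / g h) / CN := by
            simp only [hu, true_and]; rw [if_pos ⟨Nat.pos_of_ne_zero hh0, hhj⟩]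
          rw [e1, e2]
          have hg1 : (1 - g h) ≠ 0 := by linarith
          have hgpos : 0 < g h := (hg h).1
          have : g h * (R * (μ h * (1 - g h) / g h) / CN / (1 - g h)) = (R / CN) * μ h := by
            field_simp
          rw [this]
          have hRC : R / CN ≤ 1 := (div_le_one hCNpos).2 hRCN
          have := mul_le_mul_of_nonneg_right hRC (hμ0 h)
          linarith
        · have e1 : G 0 h = 0 := by simp only [hGdef]; rw [if_neg hgh]
          rw [e1, zero_mul]; exact hμ0 h
      · intro l _ hl
        have : u l h = 0 := by simp only [hu]; rw [if_neg (fun hc => hl hc.1)]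
        rw [this, zero_div, mul_zero]
      · intro hn; exact absurd (Finset.mem_range.2 (Nat.succ_pos j')) hn
    exact decAt_of_absorb_flows x j' M μ f u G hjM hμ0 hμM hμ1 hx0 hx1 hf0 hbal hu0 hG huse hlow hcap'

end LawDec

end Quant

end Summit.CriticalPhenomena.PercolationContinuityZ3.Theorems
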